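import Summits.QuantumFields.BalabanUV.T4Continuum.Spine.NE1p.DressedSourceAnalyticSlotsOfRecord
import Summits.QuantumFields.BalabanUV.T4Continuum.Spine.NE1p.DressedSourceAnalyticSlotLettersTorus

/-!
# T⁴ programme, spine estimate NE1′ (node O3b/H2) — S46's THREE GEOMETRY-BEARING ENDs READ AT THE ACTIVITY SLOT OF RECORD
# `(slotsOfRecord …).act`, ON THE TORUS OF THE PAPERS: holomorphy in the source + the (2.41) envelope, the linear response, and joint
# (operator datum, source) holomorphy of the dressed output `σ ↦ E[Σ_{p ∈ terms Z} (slotsOfRecord …).act p.1 p.2 op (h₀ + σ • v)](X₀)` at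
# pv22's `tgeometry 4 N` — NO geometry hypothesis, constants LOCATED (ν = 9, c₁ = 64, K₀ = K₀(64,8), κ₀ = 64·log 162, b₅ = 5·r₁);
# S31-torus §3's pattern VERBATIM for S50-B (the fourth corner of the square {`coreLettersOf A`, `(slotsOfRecord …).act`} × {abstract
# geometry, pv22's torus} for S46's analytic ENDs: S46 ∕ S50-A ∕ S50-B ∕ THIS FILE)

Cell `pub-balaban`, sub-cell `t4`, BINDER-OWNERS row NE1′ (owner lineage t4-ne1p-p1); NE1′ formalisation crew, unit
`b2b-balaban-t4-ne1p-formalise-leaf-07` (LEAF PROVER 07, generation 19); crew row S60 ∕ DAG N29zzzzw of `t4/formal/NE1p/LEAVES.md` (BOOKED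
typer R-T144, `CLAIMS.log` l.23862; INTENT l.23839; owner GO l.23873; read X227) — own-lineage
torus column of S50-B `Spine/NE1p/DressedSourceAnalyticSlotsOfRecord` (p237241; this unit, generation 17), exactly as S50-A is S46's,
S52-B is S52-A's and S58 `DressedRegenerationLinearTorus` is S55's.  ADDITIVE — imports S50-B
`Spine/NE1p/DressedSourceAnalyticSlotsOfRecord` (→ S46 `DressedSourceAnalyticSlotLetters` → S42 → S33 → N0r … → S30
`DressedSmallFieldOnCoresSlotLetters` → the SUBSTRATE cell's `Support/SubstrateSlotsOfRecord` (`SlotLetters`, `slotsOfRecord`,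
`slotsOfRecord_act`, `SpeciesRec`); row NE5's `B13OpDatum` (`OpDatum`) ∕ `B13StepTermLabels` (`InnerLabel`) ∕ `B13InnerData` (`Bnd`)) and
S50-A `Spine/NE1p/DressedSourceAnalyticSlotLettersTorus` (p237028; → S24 `DressedSmallFieldGeometryFaces` (`K₀_four`) → N0o
`DressedSmallFieldGeometry` (`torus_consts`) → pv22's `TreeLengthTorusGeometry` (`tgeometry`, `TTouch`)) ONLY — both LANDED; THEOREMS ONLY
(3 `theorem` + 1 consistency `example`; 0 `def`, 0 `def … : Prop`, 0 cite, 0 sorry); nothing of S50-A ∕ S50-B ∕ S46 ∕ S30 ∕ S31 ∕ S24 ∕ N0o ∕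
the substrate ∕ row NE5 is restated — their declarations are used BY NAME.

FILE-AND-LINE PREMISE (tree grep at INTENT, 241-module `Spine/NE1p`).  S50-B's three geometry-bearing theorems
`analytic_and_bounded_locE_slotsOfRecord_act` (l.138), `muDeriv_locE_le_slotsOfRecord_act` (l.182),
`analytic_and_bounded_locE_opSource_slotsOfRecord_act` (l.230) occur in their own module ONLY — 0 appliers, no torus reading; the
attached-part ∕ μ-part ENDs at the slot of record HAVE their torus reading (S31-torus `DressedSmallFieldOnCoresSlotLettersTorus` §3
`attachedPart_locE_le_slotsOfRecord_act_torus` l.304 ∕ `muPart_locE_le_slotsOfRecord_act_torus` l.351); S46's analytic ENDs have their torus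
reading at `coreLettersOf A` only (S50-A).  S50-B §1 `termLineAnalytic_slotsOfRecord_act` carries NO geometry (row NE5's `TermLineAnalytic`
is a statement about the term line, not about `E`), so it has no torus column and is not repeated.

WHAT THIS FILE PROVES (each: `obtain ⟨hν, hκ, hc'⟩ := torus_consts N`, S50-B §k ONCE BY NAME at `(𝔇, Ge) := (tsys 4 N, tgeometry 4 N)`,
`b₅ := 5·r₁` (`hb` by `ring`), `hrate` ∕ `hsmall` transported by `rw [hκ]` ∕ `rw [K₀_four, hν, hc']`, then `rw [hν, hc', K₀_four] at h;
exact h` — S31-torus §3 VERBATIM):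
* §1 **`analytic_and_bounded_locE_slotsOfRecord_act_torus`** (kernel; S50-B §2a ONCE): `σ ↦ E[Σ (slotsOfRecord …).act p.1 p.2 op (h₀ + σ •
  v)](X₀)` is complex differentiable on `‖σ‖ < μ₁` and bounded there by `e·9·64·K₀(64,8)²·A′·e^{−r₁·torusTreeLen X₀}`;
* §1 **`muDeriv_locE_le_slotsOfRecord_act_torus`** (kernel; S50-B §2b ONCE): for `‖sμ‖ ≤ μ₀ < μ₁` the source derivative at `sμ` is
  `≤ 2·(e·9·64·K₀(64,8)²·A′·e^{−r₁·torusTreeLen X₀})∕(μ₁ − μ₀)`;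
* §2 **`analytic_and_bounded_locE_opSource_slotsOfRecord_act_torus`** (kernel; S50-B §3 ONCE): joint holomorphy in `(op, σ)` on
  `ball (ctr k g U).1 (ROp k) ×ˢ ball 0 μ₁` + the same envelope;
* §3 (consistency `example`, no new statement): §1's holomorphy face closed THE OTHER WAY ROUND THE SQUARE — `rw [slotsOfRecord_act]` then
  S50-A §1 `analytic_and_bounded_locE_of_coreLettersOf_torus` at `A := L.A` — torus-then-slot = slot-then-torus in kernel.
Binders LITERALLY S50-B's with the geometry GONE (`𝔇`, `Ge`, `b₅`, `hb`) and the torus size `N` implicit; every conclusion pins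
`locE (Dom := (tsys 4 N).Dom) …` (S31 ∕ S50-A ∕ S52-B's ELABORATION NOTE: the substrate's `Support/B13Carriers` in the cone registers the global
instance `TwoRuns.instDecidableEqTDom`; pinned, the statements print as S50-A's and close by S50-B BY NAME).  CENSUS (binders, by name) vs
S50-B §2a ∕ §2b ∕ §3: MINUS = [`𝔇`, `Cube`, `Ge`, `b₅`, `hb`]; PLUS = [`N`]; rest IDENTICAL; vs S50-A §1's three: MINUS = [`Op`, `J`, `A`]
(specialised to `OpDatum (SpeciesRec …)` ∕ `InnerLabel …` ∕ `L.A`); PLUS = [the slots-of-record letters `o`, `ι`, `c`, `a`, `s`, `T`, `ι'`,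
`S`, `Ω`, `𝒴`, `IOp`, `L`]; `o ↦ op`, `s ↦ σ`, `a ↦ a'` in bound positions.

WHAT STAYS DISPLAYED (binders, by name; NOTHING instantiated on Bałaban's densities): the room `hroom` ∕ `hR'`; S30 §1's per-factor scalar
letter conditions on the slot letters' Gaussian tables `(L.A Z j).base` ∕ `.rd` (`hbase` ∕ `hrdm` ∕ `hβ₀` ∕ `hd₀` ∕ `hrd`), the CENTRE
CONDITIONS `hctr`, the radius smallnesses `hbud` ∕ `hmq`; the class radii `hO` ∕ `hH` at the source radius `μ₁`; (B1b)'s residue `emb` ∕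
`hscale` ∕ `terms`; the located clauses «κ large» `r₁ + 2·(64·log 162) + 2 ≤ R` and «ε₁ small» `A′·e^{5r₁+1}·K₀(64,8)·9·64 ≤ 1` ((B5)-KIND
SHAPES); (B3) = `hM3` on S30's EXPLICIT letters — G-ne9p2-5, UNPRINTED, shared with NE9, a BINDER, never `[cite:`-tagged.  (B4) is
discharged BY NAME on pv22's CONSTRUCTED torus geometry (pv22's READING of 𝐃_{k+1} ∕ d_{k+1}, DIVERGENCE D-pv22.3 — not asserted here).  The
class centre `ctr` stays GENERAL: its identification with run B's operator datum of record `opOf (slotsOfRecord …).F (slotsOfRecord …).rawB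
g U k` and with NE1′'s window classes is the substrate's ∕ the owner's READING — NOT asserted (S30 §3 ∕ S50-B's sentence, verbatim in
substance).  Which tables realise Bałaban's `C^{(k)}(Z₀,σ)`, `Γ_k` of [Balaban1988RGII] (2.14) p. 15 is the SUBSTRATE's displayed
identification, NOT claimed.

HONEST FRAMING.  By-name specialisation of S50-B at a constructed geometry — KERNEL only RELATIVE TO the displayed inputs ([folklore]
plumbing: one `torus_consts`, one application of S50-B per theorem); 0 estimates of print; printed loci ((2.14) p. 15, (2.38) ∕ (2.41)
p. 20–21 of [Balaban1988RGII]) are TYPE ∕ CONTEXT through the imported modules, re-asserted nowhere; no numeral of print; ABSOLUTE RULE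
honoured; (B1b) ∕ (B3) ∕ (B5) NOT discharged; 0 binders instantiated on Bałaban's densities; no new inequality; no wall item of NE1′ or
NE5 moves; the NE1′ wall wording of record (v1.8, T4-DAG v48 ∕ v49 — words, not kind) does NOT move; R-t4r2-Q2 NOT met thereby; NE1′ ⇐
the named binders — NOT printed, NOT proved; spine PROVED 0∕9; count 9 unchanged.  Rung (B)+1 on ONE finite four-torus — NOT infinite
volume, NOT a mass gap, NOT OS on ℝ⁴, NOT Clay.  HONEST DEPENDENCY: continuum YM on T⁴ ⇐ BetaPertH ∧ nine spine estimates (0/9 proved);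
BetaPertH ⇐ (D1) ∧ (D4) ∧ CAP+tail; G-an2-4 gates asym, D1 and NE2/3/4.
-/

noncomputable section

namespace Summit.QuantumFields.BalabanUV.T4Continuum.NE1p.DressedSourceAnalyticSlotsOfRecordTorus

open scoped BigOperators Matrix
open Metric Set MeasureTheory
open Literature.MathematicalPhysics.QuantumFieldTheory.Balaban1983to89
open Literature.MathematicalPhysics.QuantumFieldTheory.Balaban1983to89.B13Resummation (locE)
open Literature.MathematicalPhysics.QuantumFieldTheory.Balaban1983to89.B5Prop11Lower (nsq)
open Literature.MathematicalPhysics.QuantumFieldTheory.Balaban1983to89.TreeLengthTorus (tsys torusTreeLen)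
open Literature.MathematicalPhysics.QuantumFieldTheory.Balaban1983to89.TreeLengthTorusGeometry (TTouch tgeometry)
open Literature.MathematicalPhysics.QuantumFieldTheory.Balaban1983to89.B12TreeDecay (K₀)
open Summit.QuantumFields.BalabanUV.T4Continuum.B13OpDatum (OpDatum)
open Summit.QuantumFields.BalabanUV.T4Continuum.B13HistMeasurable (MeasPotFrame B13HistM)
open Summit.QuantumFields.BalabanUV.T4Continuum.B13StepTermLabels (InnerLabel)
open Summit.QuantumFields.BalabanUV.T4Continuum.B13InnerData (Bnd)
open Summit.QuantumFields.BalabanUV.T4Continuum.SubstrateTwoRunsDriven (DrivenRuns)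
open Summit.QuantumFields.BalabanUV.T4Continuum.SubstrateActivities (coreOf actOfLetters)
open Summit.QuantumFields.BalabanUV.T4Continuum.SubstrateGaussianLetters (gaussC linForm)
open Summit.QuantumFields.BalabanUV.T4Continuum.SubstrateGaussianLettersBall (detBudget)
open Summit.QuantumFields.BalabanUV.T4Continuum.SubstrateSlotsOfRecord (ActLetters coreLettersOf SpeciesRec SlotLetters slotsOfRecord
  slotsOfRecord_act)
open Summit.QuantumFields.BalabanUV.T4Continuum.NE1p.DressedSourceAnalyticSlotsOfRecord (analytic_and_bounded_locE_slotsOfRecord_act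
  muDeriv_locE_le_slotsOfRecord_act analytic_and_bounded_locE_opSource_slotsOfRecord_act)
open Summit.QuantumFields.BalabanUV.T4Continuum.NE1p.DressedSourceAnalyticSlotLettersTorus (analytic_and_bounded_locE_of_coreLettersOf_torus)
open Summit.QuantumFields.BalabanUV.T4Continuum.NE1p.DressedSmallFieldGeometry (torus_consts)
open Summit.QuantumFields.BalabanUV.T4Continuum.NE1p.DressedSmallFieldGeometryFaces (K₀_four)

variable {G : Type} [GaugeGroup G] (D : DrivenRuns G) (P : MeasPotFrame D.carriers) {N : ℕ} [NeZero N]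

section SlotsOfRecord

variable {o : Type} [Fintype o] [DecidableEq o] (ι : G →* Matrix o o ℂ) (c : ℂ) (a : ℝ) (s : ℕ → ℂ)
variable {T ι' S Ω 𝒴 : Type} {IOp : Type*}
  (𝒵 : D.carriers.Dom → InnerLabel D.carriers.Dom (Bnd D.toTwoRuns) → Type) [∀ Z j, Fintype (𝒵 Z j)]
  (dom : ∀ Z j, 𝒵 Z j → D.carriers.Dom)
  (Jc : D.carriers.Dom → InnerLabel D.carriers.Dom (Bnd D.toTwoRuns) → Type) [∀ Z j, Fintype (Jc Z j)]
  (V : D.carriers.Dom → InnerLabel D.carriers.Dom (Bnd D.toTwoRuns) → Type) [∀ Z j, NormedAddCommGroup (V Z j)]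
  [∀ Z j, InnerProductSpace ℝ (V Z j)] [∀ Z j, MeasurableSpace (V Z j)] [∀ Z j, BorelSpace (V Z j)] [∀ Z j, FiniteDimensional ℝ (V Z j)]
  (mI : D.carriers.Dom → InnerLabel D.carriers.Dom (Bnd D.toTwoRuns) → Type) [∀ Z j, Fintype (mI Z j)] [∀ Z j, DecidableEq (mI Z j)]
  (L : SlotLetters D (o := o) (T := T) (ι' := ι') (S := S) (Ω := Ω) (𝒴 := 𝒴) P (IOp := IOp) 𝒵 dom Jc V mI)

/-! ## §1 HOLOMORPHY IN THE SOURCE + THE (2.41) ENVELOPE, AND THE LINEAR RESPONSE, OF THE DRESSED OUTPUT OF THE SLOT OF RECORD, ON THE TORUS -/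

open Classical in
/-- **HOLOMORPHY IN THE SOURCE + THE (2.41) ENVELOPE OF THE DRESSED OUTPUT OF THE ACTIVITY SLOT OF RECORD, ON THE TORUS** (kernel;
S50-B §2 `analytic_and_bounded_locE_slotsOfRecord_act` ONCE BY NAME at `𝔇 := tsys 4 N`, `Ge := tgeometry 4 N`, `b₅ := 5·r₁`, constants
located by N0o `torus_consts` + S24 `K₀_four`): binders = S50-B §2's with the geometry GONE; activities LITERALLY
`(slotsOfRecord D ι c a s P 𝒵 dom Jc V mI L).act p.1 p.2 op (h₀ + σ • v)`; class centre `ctr` GENERAL (its identification with run B's operator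
datum of record is the substrate's READING, NOT asserted). [folklore] -/
theorem analytic_and_bounded_locE_slotsOfRecord_act_torus {W : Set (ℕ → ℝ)}
    {ctr : ℕ → (ℕ → ℝ) → D.carriers.BgB → OpDatum (SpeciesRec D o T ι' Ω 𝒴) × B13HistM P} {ROp RHist R' : ℕ → ℝ}
    {β₀ ϑ d₀ γ : D.carriers.Dom → InnerLabel D.carriers.Dom (Bnd D.toTwoRuns) → ℝ}
    (hroom : ∀ k, ROp k < R' k) (hR' : ∀ k, 0 ≤ R' k)
    (hbase : ∀ Z j ii jj, Measurable fun a' => (L.A Z j).base a' ii jj)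
    (hrdm : ∀ Z j ii jj (o' : OpDatum (SpeciesRec D o T ι' Ω 𝒴)), Measurable fun a' => (L.A Z j).rd a' ii jj o')
    (hβ₀ : ∀ Z j, 0 ≤ β₀ Z j) (hd₀ : ∀ Z j, 0 < d₀ Z j)
    (hrd : ∀ Z j a' ii jj, ‖(L.A Z j).rd a' ii jj‖ ≤ ϑ Z j)
    (hctr : ∀ k, ∀ g ∈ W, ∀ (U : D.carriers.BgB) (Z : D.carriers.Dom) (j : InnerLabel D.carriers.Dom (Bnd D.toTwoRuns))
      (a' : (Jc Z j ⊕ 𝒵 Z j) → ℝ × ℝ),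
      (∀ ii jj, ‖linForm (L.A Z j).base (L.A Z j).rd (ctr k g U).1 a' ii jj‖ ≤ β₀ Z j) ∧
      ((linForm (L.A Z j).base (L.A Z j).rd (ctr k g U).1 a').det).im = 0 ∧ d₀ Z j ≤ ((linForm (L.A Z j).base (L.A Z j).rd (ctr k g U).1 a').det).re ∧
      (∀ x : mI Z j → ℂ, γ Z j * nsq x ≤ (star x ⬝ᵥ (linForm (L.A Z j).base (L.A Z j).rd (ctr k g U).1 a' *ᵥ x)).re))
    (hbud : ∀ k Z j, detBudget (Fintype.card (mI Z j)) (β₀ Z j) (ϑ Z j) (R' k) < d₀ Z j)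
    (hmq : ∀ k Z j, Fintype.card (mI Z j) * ϑ Z j * R' k < γ Z j)
    {k : ℕ} {g : ℕ → ℝ} (hg : g ∈ W) {U : D.carriers.BgB} {op : OpDatum (SpeciesRec D o T ι' Ω 𝒴)} {h₀ v : B13HistM P} {μ₁ : ℝ}
    (hO : ‖op - (ctr k g U).1‖ ≤ ROp k) (hH : ‖h₀ - (ctr k g U).2‖ + μ₁ * ‖v‖ ≤ RHist k)
    {emb : (tsys 4 N).Dom → D.carriers.Dom} (hscale : ∀ Z, D.carriers.scale (emb Z) = k)
    (terms : (tsys 4 N).Dom → Finset (D.carriers.Dom × InnerLabel D.carriers.Dom (Bnd D.toTwoRuns)))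
    {A' R r₁ : ℝ} (X₀ : (tsys 4 N).Dom) (hA : 0 ≤ A') (hr₁ : 0 ≤ r₁)
    (hrate : r₁ + 2 * (64 * Real.log 162) + 2 ≤ R) (hsmall : A' * Real.exp (5 * r₁ + 1) * K₀ 64 8 * 9 * 64 ≤ 1)
    (hM3 : ∀ Z : (tsys 4 N).Dom, Z.1 ⊆ X₀.1 →
      ∑ p ∈ terms Z, (coreOf P (OpDatum (SpeciesRec D o T ι' Ω 𝒴)) 𝒵 dom Jc V
            (coreLettersOf D P (OpDatum (SpeciesRec D o T ι' Ω 𝒴)) 𝒵 dom Jc V mI L.A) p.1 p.2).lam.real univ *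
          ((coreOf P (OpDatum (SpeciesRec D o T ι' Ω 𝒴)) 𝒵 dom Jc V
            (coreLettersOf D P (OpDatum (SpeciesRec D o T ι' Ω 𝒴)) 𝒵 dom Jc V mI L.A) p.1 p.2).wB *
              (gaussC (mI p.1 p.2) * Real.sqrt (max 1 ((Fintype.card (mI p.1 p.2)).factorial *
                β₀ p.1 p.2 ^ Fintype.card (mI p.1 p.2) + d₀ p.1 p.2))) * Real.exp 0) *
          (Real.pi / ((γ p.1 p.2 - Fintype.card (mI p.1 p.2) * ϑ p.1 p.2 * R' k) / 2 / 2)) ^ (Module.finrank ℝ (V p.1 p.2) / 2 : ℝ) *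
        Real.exp ((coreOf P (OpDatum (SpeciesRec D o T ι' Ω 𝒴)) 𝒵 dom Jc V
            (coreLettersOf D P (OpDatum (SpeciesRec D o T ι' Ω 𝒴)) 𝒵 dom Jc V mI L.A) p.1 p.2).N₁ * (‖h₀‖ + μ₁ * ‖v‖)) ≤
        A' * Real.exp (-(R * torusTreeLen Z.1))) :
    DifferentiableOn ℂ (fun σ => locE (Dom := (tsys 4 N).Dom) (TTouch (d := 4) (N := N)) (fun Z : (tsys 4 N).Dom => Z.1)
        (fun Z => ∑ p ∈ terms Z, (slotsOfRecord D ι c a s P 𝒵 dom Jc V mI L).act p.1 p.2 op (h₀ + σ • v))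
        X₀.1) (ball (0 : ℂ) μ₁) ∧
      ∀ σ ∈ ball (0 : ℂ) μ₁, ‖locE (Dom := (tsys 4 N).Dom) (TTouch (d := 4) (N := N)) (fun Z : (tsys 4 N).Dom => Z.1)
          (fun Z => ∑ p ∈ terms Z, (slotsOfRecord D ι c a s P 𝒵 dom Jc V mI L).act p.1 p.2 op (h₀ + σ • v))
          X₀.1‖ ≤ Real.exp 1 * 9 * 64 * K₀ 64 8 ^ 2 * A' * Real.exp (-(r₁ * torusTreeLen X₀.1)) := by
  obtain ⟨hν, hκ, hc'⟩ := torus_consts N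
  have h := analytic_and_bounded_locE_slotsOfRecord_act D P ι c a s 𝒵 dom Jc V mI L (tsys 4 N) (tgeometry 4 N) hroom hR' hbase hrdm
    hβ₀ hd₀ hrd hctr hbud hmq hg hO hH hscale terms (R := R) (b₅ := 5 * r₁) (X₀ := X₀) hA hr₁ (le_of_eq (by ring))
    (by rw [hκ]; exact hrate) (by rw [K₀_four, hν, hc']; exact hsmall) hM3
  rw [hν, hc', K₀_four] at h
  exact h

open Classical in
/-- **LINEAR RESPONSE OF THE DRESSED OUTPUT OF THE ACTIVITY SLOT OF RECORD, ON THE TORUS** (kernel; S50-B §2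
`muDeriv_locE_le_slotsOfRecord_act` ONCE BY NAME at `tgeometry 4 N`, constants located): for `‖sμ‖ ≤ μ₀ < μ₁` the source derivative of
`σ ↦ E[Σ (slotsOfRecord …).act p.1 p.2 op (h₀ + σ • v)](X₀)` at `sμ` is `≤ 2·(e·9·64·K₀(64,8)²·A′·e^{−r₁·torusTreeLen X₀})∕(μ₁ − μ₀)`.
[folklore] -/
theorem muDeriv_locE_le_slotsOfRecord_act_torus {W : Set (ℕ → ℝ)}
    {ctr : ℕ → (ℕ → ℝ) → D.carriers.BgB → OpDatum (SpeciesRec D o T ι' Ω 𝒴) × B13HistM P} {ROp RHist R' : ℕ → ℝ}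
    {β₀ ϑ d₀ γ : D.carriers.Dom → InnerLabel D.carriers.Dom (Bnd D.toTwoRuns) → ℝ}
    (hroom : ∀ k, ROp k < R' k) (hR' : ∀ k, 0 ≤ R' k)
    (hbase : ∀ Z j ii jj, Measurable fun a' => (L.A Z j).base a' ii jj)
    (hrdm : ∀ Z j ii jj (o' : OpDatum (SpeciesRec D o T ι' Ω 𝒴)), Measurable fun a' => (L.A Z j).rd a' ii jj o')
    (hβ₀ : ∀ Z j, 0 ≤ β₀ Z j) (hd₀ : ∀ Z j, 0 < d₀ Z j)
    (hrd : ∀ Z j a' ii jj, ‖(L.A Z j).rd a' ii jj‖ ≤ ϑ Z j)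
    (hctr : ∀ k, ∀ g ∈ W, ∀ (U : D.carriers.BgB) (Z : D.carriers.Dom) (j : InnerLabel D.carriers.Dom (Bnd D.toTwoRuns))
      (a' : (Jc Z j ⊕ 𝒵 Z j) → ℝ × ℝ),
      (∀ ii jj, ‖linForm (L.A Z j).base (L.A Z j).rd (ctr k g U).1 a' ii jj‖ ≤ β₀ Z j) ∧
      ((linForm (L.A Z j).base (L.A Z j).rd (ctr k g U).1 a').det).im = 0 ∧ d₀ Z j ≤ ((linForm (L.A Z j).base (L.A Z j).rd (ctr k g U).1 a').det).re ∧
      (∀ x : mI Z j → ℂ, γ Z j * nsq x ≤ (star x ⬝ᵥ (linForm (L.A Z j).base (L.A Z j).rd (ctr k g U).1 a' *ᵥ x)).re))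
    (hbud : ∀ k Z j, detBudget (Fintype.card (mI Z j)) (β₀ Z j) (ϑ Z j) (R' k) < d₀ Z j)
    (hmq : ∀ k Z j, Fintype.card (mI Z j) * ϑ Z j * R' k < γ Z j)
    {k : ℕ} {g : ℕ → ℝ} (hg : g ∈ W) {U : D.carriers.BgB} {op : OpDatum (SpeciesRec D o T ι' Ω 𝒴)} {h₀ v : B13HistM P} {μ₁ : ℝ}
    (hO : ‖op - (ctr k g U).1‖ ≤ ROp k) (hH : ‖h₀ - (ctr k g U).2‖ + μ₁ * ‖v‖ ≤ RHist k)
    {emb : (tsys 4 N).Dom → D.carriers.Dom} (hscale : ∀ Z, D.carriers.scale (emb Z) = k)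
    (terms : (tsys 4 N).Dom → Finset (D.carriers.Dom × InnerLabel D.carriers.Dom (Bnd D.toTwoRuns)))
    {A' R r₁ μ₀ : ℝ} (X₀ : (tsys 4 N).Dom) {sμ : ℂ} (hA : 0 ≤ A') (hr₁ : 0 ≤ r₁)
    (hrate : r₁ + 2 * (64 * Real.log 162) + 2 ≤ R) (hsmall : A' * Real.exp (5 * r₁ + 1) * K₀ 64 8 * 9 * 64 ≤ 1)
    (hM3 : ∀ Z : (tsys 4 N).Dom, Z.1 ⊆ X₀.1 →
      ∑ p ∈ terms Z, (coreOf P (OpDatum (SpeciesRec D o T ι' Ω 𝒴)) 𝒵 dom Jc V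
            (coreLettersOf D P (OpDatum (SpeciesRec D o T ι' Ω 𝒴)) 𝒵 dom Jc V mI L.A) p.1 p.2).lam.real univ *
          ((coreOf P (OpDatum (SpeciesRec D o T ι' Ω 𝒴)) 𝒵 dom Jc V
            (coreLettersOf D P (OpDatum (SpeciesRec D o T ι' Ω 𝒴)) 𝒵 dom Jc V mI L.A) p.1 p.2).wB *
              (gaussC (mI p.1 p.2) * Real.sqrt (max 1 ((Fintype.card (mI p.1 p.2)).factorial *
                β₀ p.1 p.2 ^ Fintype.card (mI p.1 p.2) + d₀ p.1 p.2))) * Real.exp 0) *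
          (Real.pi / ((γ p.1 p.2 - Fintype.card (mI p.1 p.2) * ϑ p.1 p.2 * R' k) / 2 / 2)) ^ (Module.finrank ℝ (V p.1 p.2) / 2 : ℝ) *
        Real.exp ((coreOf P (OpDatum (SpeciesRec D o T ι' Ω 𝒴)) 𝒵 dom Jc V
            (coreLettersOf D P (OpDatum (SpeciesRec D o T ι' Ω 𝒴)) 𝒵 dom Jc V mI L.A) p.1 p.2).N₁ * (‖h₀‖ + μ₁ * ‖v‖)) ≤
        A' * Real.exp (-(R * torusTreeLen Z.1)))
    (h01 : μ₀ < μ₁) (hμ : ‖sμ‖ ≤ μ₀) :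
    ‖deriv (fun σ => locE (Dom := (tsys 4 N).Dom) (TTouch (d := 4) (N := N)) (fun Z : (tsys 4 N).Dom => Z.1)
        (fun Z => ∑ p ∈ terms Z, (slotsOfRecord D ι c a s P 𝒵 dom Jc V mI L).act p.1 p.2 op (h₀ + σ • v))
        X₀.1) sμ‖ ≤
      2 * (Real.exp 1 * 9 * 64 * K₀ 64 8 ^ 2 * A' * Real.exp (-(r₁ * torusTreeLen X₀.1))) / (μ₁ - μ₀) := by
  obtain ⟨hν, hκ, hc'⟩ := torus_consts N
  have h := muDeriv_locE_le_slotsOfRecord_act D P ι c a s 𝒵 dom Jc V mI L (tsys 4 N) (tgeometry 4 N) hroom hR' hbase hrdm hβ₀ hd₀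
    hrd hctr hbud hmq hg hO hH hscale terms (R := R) (b₅ := 5 * r₁) (X₀ := X₀) (sμ := sμ) hA hr₁ (le_of_eq (by ring))
    (by rw [hκ]; exact hrate) (by rw [K₀_four, hν, hc']; exact hsmall) hM3 h01 hμ
  rw [hν, hc', K₀_four] at h
  exact h

/-! ## §2 THE JOINT (OPERATOR DATUM, SOURCE) END AT THE ACTIVITY SLOT OF RECORD, ON THE TORUS -/

open Classical in
/-- **JOINT HOLOMORPHY IN (OPERATOR DATUM, SOURCE) + THE (2.41) ENVELOPE OF THE DRESSED OUTPUT OF THE ACTIVITY SLOT OF RECORD, ON THE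
TORUS** (kernel; S50-B §3 `analytic_and_bounded_locE_opSource_slotsOfRecord_act` ONCE BY NAME at `tgeometry 4 N`, constants located):
binders = §1's WITHOUT `op` ∕ `hO`; `(op, σ) ↦ E[Σ (slotsOfRecord …).act p.1 p.2 op (h₀ + σ • v)](X₀)` is complex differentiable on
`ball (ctr k g U).1 (ROp k) ×ˢ ball 0 μ₁` and bounded there by `e·9·64·K₀(64,8)²·A′·e^{−r₁·torusTreeLen X₀}` — S30 §1's operator-HOLOMORPHY
clauses load-bearing, for the (2.14) slot of record as a function of ITS operator datum `OpDatum (SpeciesRec …)`. [folklore] -/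
theorem analytic_and_bounded_locE_opSource_slotsOfRecord_act_torus {W : Set (ℕ → ℝ)}
    {ctr : ℕ → (ℕ → ℝ) → D.carriers.BgB → OpDatum (SpeciesRec D o T ι' Ω 𝒴) × B13HistM P} {ROp RHist R' : ℕ → ℝ}
    {β₀ ϑ d₀ γ : D.carriers.Dom → InnerLabel D.carriers.Dom (Bnd D.toTwoRuns) → ℝ}
    (hroom : ∀ k, ROp k < R' k) (hR' : ∀ k, 0 ≤ R' k)
    (hbase : ∀ Z j ii jj, Measurable fun a' => (L.A Z j).base a' ii jj)
    (hrdm : ∀ Z j ii jj (o' : OpDatum (SpeciesRec D o T ι' Ω 𝒴)), Measurable fun a' => (L.A Z j).rd a' ii jj o')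
    (hβ₀ : ∀ Z j, 0 ≤ β₀ Z j) (hd₀ : ∀ Z j, 0 < d₀ Z j)
    (hrd : ∀ Z j a' ii jj, ‖(L.A Z j).rd a' ii jj‖ ≤ ϑ Z j)
    (hctr : ∀ k, ∀ g ∈ W, ∀ (U : D.carriers.BgB) (Z : D.carriers.Dom) (j : InnerLabel D.carriers.Dom (Bnd D.toTwoRuns))
      (a' : (Jc Z j ⊕ 𝒵 Z j) → ℝ × ℝ),
      (∀ ii jj, ‖linForm (L.A Z j).base (L.A Z j).rd (ctr k g U).1 a' ii jj‖ ≤ β₀ Z j) ∧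
      ((linForm (L.A Z j).base (L.A Z j).rd (ctr k g U).1 a').det).im = 0 ∧ d₀ Z j ≤ ((linForm (L.A Z j).base (L.A Z j).rd (ctr k g U).1 a').det).re ∧
      (∀ x : mI Z j → ℂ, γ Z j * nsq x ≤ (star x ⬝ᵥ (linForm (L.A Z j).base (L.A Z j).rd (ctr k g U).1 a' *ᵥ x)).re))
    (hbud : ∀ k Z j, detBudget (Fintype.card (mI Z j)) (β₀ Z j) (ϑ Z j) (R' k) < d₀ Z j)
    (hmq : ∀ k Z j, Fintype.card (mI Z j) * ϑ Z j * R' k < γ Z j)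
    {k : ℕ} {g : ℕ → ℝ} (hg : g ∈ W) {U : D.carriers.BgB} {h₀ v : B13HistM P} {μ₁ : ℝ}
    (hH : ‖h₀ - (ctr k g U).2‖ + μ₁ * ‖v‖ ≤ RHist k)
    {emb : (tsys 4 N).Dom → D.carriers.Dom} (hscale : ∀ Z, D.carriers.scale (emb Z) = k)
    (terms : (tsys 4 N).Dom → Finset (D.carriers.Dom × InnerLabel D.carriers.Dom (Bnd D.toTwoRuns)))
    {A' R r₁ : ℝ} (X₀ : (tsys 4 N).Dom) (hA : 0 ≤ A') (hr₁ : 0 ≤ r₁)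
    (hrate : r₁ + 2 * (64 * Real.log 162) + 2 ≤ R) (hsmall : A' * Real.exp (5 * r₁ + 1) * K₀ 64 8 * 9 * 64 ≤ 1)
    (hM3 : ∀ Z : (tsys 4 N).Dom, Z.1 ⊆ X₀.1 →
      ∑ p ∈ terms Z, (coreOf P (OpDatum (SpeciesRec D o T ι' Ω 𝒴)) 𝒵 dom Jc V
            (coreLettersOf D P (OpDatum (SpeciesRec D o T ι' Ω 𝒴)) 𝒵 dom Jc V mI L.A) p.1 p.2).lam.real univ *
          ((coreOf P (OpDatum (SpeciesRec D o T ι' Ω 𝒴)) 𝒵 dom Jc V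
            (coreLettersOf D P (OpDatum (SpeciesRec D o T ι' Ω 𝒴)) 𝒵 dom Jc V mI L.A) p.1 p.2).wB *
              (gaussC (mI p.1 p.2) * Real.sqrt (max 1 ((Fintype.card (mI p.1 p.2)).factorial *
                β₀ p.1 p.2 ^ Fintype.card (mI p.1 p.2) + d₀ p.1 p.2))) * Real.exp 0) *
          (Real.pi / ((γ p.1 p.2 - Fintype.card (mI p.1 p.2) * ϑ p.1 p.2 * R' k) / 2 / 2)) ^ (Module.finrank ℝ (V p.1 p.2) / 2 : ℝ) *
        Real.exp ((coreOf P (OpDatum (SpeciesRec D o T ι' Ω 𝒴)) 𝒵 dom Jc V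
            (coreLettersOf D P (OpDatum (SpeciesRec D o T ι' Ω 𝒴)) 𝒵 dom Jc V mI L.A) p.1 p.2).N₁ * (‖h₀‖ + μ₁ * ‖v‖)) ≤
        A' * Real.exp (-(R * torusTreeLen Z.1))) :
    DifferentiableOn ℂ (fun z : OpDatum (SpeciesRec D o T ι' Ω 𝒴) × ℂ =>
        locE (Dom := (tsys 4 N).Dom) (TTouch (d := 4) (N := N)) (fun Z : (tsys 4 N).Dom => Z.1) (fun Z => ∑ p ∈ terms Z,
        (slotsOfRecord D ι c a s P 𝒵 dom Jc V mI L).act p.1 p.2 z.1 (h₀ + z.2 • v)) X₀.1)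
        (ball (ctr k g U).1 (ROp k) ×ˢ ball (0 : ℂ) μ₁) ∧
      ∀ z ∈ ball (ctr k g U).1 (ROp k) ×ˢ ball (0 : ℂ) μ₁,
        ‖locE (Dom := (tsys 4 N).Dom) (TTouch (d := 4) (N := N)) (fun Z : (tsys 4 N).Dom => Z.1) (fun Z => ∑ p ∈ terms Z,
          (slotsOfRecord D ι c a s P 𝒵 dom Jc V mI L).act p.1 p.2 z.1 (h₀ + z.2 • v)) X₀.1‖ ≤
        Real.exp 1 * 9 * 64 * K₀ 64 8 ^ 2 * A' * Real.exp (-(r₁ * torusTreeLen X₀.1)) := by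
  obtain ⟨hν, hκ, hc'⟩ := torus_consts N
  have h := analytic_and_bounded_locE_opSource_slotsOfRecord_act D P ι c a s 𝒵 dom Jc V mI L (tsys 4 N) (tgeometry 4 N) hroom hR'
    hbase hrdm hβ₀ hd₀ hrd hctr hbud hmq hg hH hscale terms (R := R) (b₅ := 5 * r₁) (X₀ := X₀) hA hr₁ (le_of_eq (by ring))
    (by rw [hκ]; exact hrate) (by rw [K₀_four, hν, hc']; exact hsmall) hM3
  rw [hν, hc', K₀_four] at h
  exact h

/-! ## §3 THE SQUARE COMMUTES IN KERNEL (slot-then-torus = torus-then-slot) — no new statement -/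

open Classical in
/-- (consistency, in kernel) §1's `analytic_and_bounded_locE_slotsOfRecord_act_torus` IS S50-A §1's
`analytic_and_bounded_locE_of_coreLettersOf_torus` at `Op := OpDatum (SpeciesRec D o T ι′ Ω 𝒴)`, `A := L.A` after the substrate's
`slotsOfRecord_act` (`rfl`) — S50-B's two-line pattern at the torus in place of S50-B at the torus: the same statement closed the other
way round the square. [folklore] -/
example {W : Set (ℕ → ℝ)}
    {ctr : ℕ → (ℕ → ℝ) → D.carriers.BgB → OpDatum (SpeciesRec D o T ι' Ω 𝒴) × B13HistM P} {ROp RHist R' : ℕ → ℝ}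
    {β₀ ϑ d₀ γ : D.carriers.Dom → InnerLabel D.carriers.Dom (Bnd D.toTwoRuns) → ℝ}
    (hroom : ∀ k, ROp k < R' k) (hR' : ∀ k, 0 ≤ R' k)
    (hbase : ∀ Z j ii jj, Measurable fun a' => (L.A Z j).base a' ii jj)
    (hrdm : ∀ Z j ii jj (o' : OpDatum (SpeciesRec D o T ι' Ω 𝒴)), Measurable fun a' => (L.A Z j).rd a' ii jj o')
    (hβ₀ : ∀ Z j, 0 ≤ β₀ Z j) (hd₀ : ∀ Z j, 0 < d₀ Z j)
    (hrd : ∀ Z j a' ii jj, ‖(L.A Z j).rd a' ii jj‖ ≤ ϑ Z j)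
    (hctr : ∀ k, ∀ g ∈ W, ∀ (U : D.carriers.BgB) (Z : D.carriers.Dom) (j : InnerLabel D.carriers.Dom (Bnd D.toTwoRuns))
      (a' : (Jc Z j ⊕ 𝒵 Z j) → ℝ × ℝ),
      (∀ ii jj, ‖linForm (L.A Z j).base (L.A Z j).rd (ctr k g U).1 a' ii jj‖ ≤ β₀ Z j) ∧
      ((linForm (L.A Z j).base (L.A Z j).rd (ctr k g U).1 a').det).im = 0 ∧ d₀ Z j ≤ ((linForm (L.A Z j).base (L.A Z j).rd (ctr k g U).1 a').det).re ∧
      (∀ x : mI Z j → ℂ, γ Z j * nsq x ≤ (star x ⬝ᵥ (linForm (L.A Z j).base (L.A Z j).rd (ctr k g U).1 a' *ᵥ x)).re))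
    (hbud : ∀ k Z j, detBudget (Fintype.card (mI Z j)) (β₀ Z j) (ϑ Z j) (R' k) < d₀ Z j)
    (hmq : ∀ k Z j, Fintype.card (mI Z j) * ϑ Z j * R' k < γ Z j)
    {k : ℕ} {g : ℕ → ℝ} (hg : g ∈ W) {U : D.carriers.BgB} {op : OpDatum (SpeciesRec D o T ι' Ω 𝒴)} {h₀ v : B13HistM P} {μ₁ : ℝ}
    (hO : ‖op - (ctr k g U).1‖ ≤ ROp k) (hH : ‖h₀ - (ctr k g U).2‖ + μ₁ * ‖v‖ ≤ RHist k)
    {emb : (tsys 4 N).Dom → D.carriers.Dom} (hscale : ∀ Z, D.carriers.scale (emb Z) = k)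
    (terms : (tsys 4 N).Dom → Finset (D.carriers.Dom × InnerLabel D.carriers.Dom (Bnd D.toTwoRuns)))
    {A' R r₁ : ℝ} (X₀ : (tsys 4 N).Dom) (hA : 0 ≤ A') (hr₁ : 0 ≤ r₁)
    (hrate : r₁ + 2 * (64 * Real.log 162) + 2 ≤ R) (hsmall : A' * Real.exp (5 * r₁ + 1) * K₀ 64 8 * 9 * 64 ≤ 1)
    (hM3 : ∀ Z : (tsys 4 N).Dom, Z.1 ⊆ X₀.1 →
      ∑ p ∈ terms Z, (coreOf P (OpDatum (SpeciesRec D o T ι' Ω 𝒴)) 𝒵 dom Jc V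
            (coreLettersOf D P (OpDatum (SpeciesRec D o T ι' Ω 𝒴)) 𝒵 dom Jc V mI L.A) p.1 p.2).lam.real univ *
          ((coreOf P (OpDatum (SpeciesRec D o T ι' Ω 𝒴)) 𝒵 dom Jc V
            (coreLettersOf D P (OpDatum (SpeciesRec D o T ι' Ω 𝒴)) 𝒵 dom Jc V mI L.A) p.1 p.2).wB *
              (gaussC (mI p.1 p.2) * Real.sqrt (max 1 ((Fintype.card (mI p.1 p.2)).factorial *
                β₀ p.1 p.2 ^ Fintype.card (mI p.1 p.2) + d₀ p.1 p.2))) * Real.exp 0) *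
          (Real.pi / ((γ p.1 p.2 - Fintype.card (mI p.1 p.2) * ϑ p.1 p.2 * R' k) / 2 / 2)) ^ (Module.finrank ℝ (V p.1 p.2) / 2 : ℝ) *
        Real.exp ((coreOf P (OpDatum (SpeciesRec D o T ι' Ω 𝒴)) 𝒵 dom Jc V
            (coreLettersOf D P (OpDatum (SpeciesRec D o T ι' Ω 𝒴)) 𝒵 dom Jc V mI L.A) p.1 p.2).N₁ * (‖h₀‖ + μ₁ * ‖v‖)) ≤
        A' * Real.exp (-(R * torusTreeLen Z.1))) :
    DifferentiableOn ℂ (fun σ => locE (Dom := (tsys 4 N).Dom) (TTouch (d := 4) (N := N)) (fun Z : (tsys 4 N).Dom => Z.1)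
        (fun Z => ∑ p ∈ terms Z, (slotsOfRecord D ι c a s P 𝒵 dom Jc V mI L).act p.1 p.2 op (h₀ + σ • v))
        X₀.1) (ball (0 : ℂ) μ₁) ∧
      ∀ σ ∈ ball (0 : ℂ) μ₁, ‖locE (Dom := (tsys 4 N).Dom) (TTouch (d := 4) (N := N)) (fun Z : (tsys 4 N).Dom => Z.1)
          (fun Z => ∑ p ∈ terms Z, (slotsOfRecord D ι c a s P 𝒵 dom Jc V mI L).act p.1 p.2 op (h₀ + σ • v))
          X₀.1‖ ≤ Real.exp 1 * 9 * 64 * K₀ 64 8 ^ 2 * A' * Real.exp (-(r₁ * torusTreeLen X₀.1)) := by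
  rw [slotsOfRecord_act]
  exact analytic_and_bounded_locE_of_coreLettersOf_torus D P (OpDatum (SpeciesRec D o T ι' Ω 𝒴)) 𝒵 dom Jc V mI L.A hroom hR' hbase
    hrdm hβ₀ hd₀ hrd hctr hbud hmq hg hO hH hscale terms X₀ hA hr₁ hrate hsmall hM3

end SlotsOfRecord

end Summit.QuantumFields.BalabanUV.T4Continuum.NE1p.DressedSourceAnalyticSlotsOfRecordTorus

end
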